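import Literature.Analysis.FluidPDE.HeatKernelParabolicBounds
import Literature.Analysis.FluidPDE.MorreySlabMass
import HarnessLib

/-!
# Hölder continuity of forward parabolic potentials whose kernel is regular only for `t > 0`

Analysis/FluidPDE file in the decomposition of the named fact
`Literature.Analysis.FluidPDE.LemarieRieusset2016.prop13_4` (Lemarié-Rieusset 2016, Prop. 13.4,
p. 464), `σ(D)g`-part (`HeatPotentialHolder.lean`, `prop13_4_multiplierPart`). The kernel
`σ(D)W₊ = 1_{t>0} σ(D)W_{νt}` of that part satisfies the size bound `|σ(D)W₊| ρ₂⁴ ≤ A` everywhere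
and the gradient bounds `|∇σ(D)W₊| ≤ Cρ₂⁻⁵`, `|∂ₜσ(D)W₊| ≤ Cρ₂⁻⁶` (p. 465) **for `t > 0` only**:
it jumps across `t = 0` off the origin. The abstract theorem
`parabolicHolderOnWith_integral_of_kernel_bounds` (`ParabolicSingularPotentials.lean`) asks for
the regularity bound `|K(z) - K(z - z')| ρ₂(z)^{m+1} ≤ A ρ₂(z')` for all `2ρ₂(z') ≤ ρ₂(z)` and so
does not apply. This file **proves** the variant that does:

* `parabolicHolderOnWith_integral_of_kernel_bounds_fwd` — for a measurable kernel `K` on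
  `ℝ × ℝ³` vanishing for `t ≤ 0`, with `|K(z)| ρ₂(z)^m ≤ A` everywhere and the regularity bound
  only when, in addition, both times `z.1` and `z.1 - z'.1` are `≥ ρ₂(z')²` (so that the segment
  from `z - z'` to `z` stays in `t > 0`, where it follows from gradient bounds), and data with the
  cylinder Morrey bound `∫∫_{Q_r(c)} |F| ≤ B r^d`, `3 < m < d < m + 1`, the potential
  `∫ K(z - w) F(w) dw` (assumed absolutely convergent) is parabolic-Hölder of exponent `d - m`.
  Besides the near/far dyadic estimates of the symmetric case, the proof isolates the thin slab
  `min(t₁,t₂) - δ² < s` (`δ = ρ₂(z₁ - z₂)`), on which the two kernels are estimated separately by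
  `A |xᵢ - y|^{-m}` and the data by the thin-slab mass bound `lintegral_slab_le_of_morrey`
  (`MorreySlabMass.lean`):
* `lintegral_slab_shell_rpow_neg_mul_le` — `∫_{t-2δ² < s < t, |x-y| ≥ δ} |x - y|^{-m} |F| ≤
  C(m) B δ^{d-m}` for `m > 3` (dyadic shells in `|x - y|`, three slabs of length `δ²`).

## References

* P. G. Lemarié-Rieusset, *The Navier–Stokes Problem in the 21st Century*, CRC Press (2016),
  Prop. 13.4 and its proof, pp. 464–465. [LemarieRieusset2016]
-/

noncomputable section

open MeasureTheory Set Function Filter Metric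
open scoped NNReal ENNReal

namespace Literature.Analysis.FluidPDE

/-- Local notation for physical space `ℝ³ = EuclideanSpace ℝ (Fin 3)`. -/
local notation "ℝ³" => EuclideanSpace ℝ (Fin 3)

/-! ### The slab-shell estimate -/

section SlabShell

variable {E' : Type*} [NormedAddCommGroup E']

/-- The slab `(t - 2δ², t) × B(x, R)` is covered by three slabs of length `δ²`. [folklore] -/
theorem slab_two_subset (t δ R : ℝ) (x : ℝ³) :
    Ioo (t - 2 * δ ^ 2) t ×ˢ ball x R ⊆
      (Ioo (t - 2 * δ ^ 2) (t - 2 * δ ^ 2 + δ ^ 2) ×ˢ ball x R ∪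
        Ioo (t - 3 / 2 * δ ^ 2) (t - 3 / 2 * δ ^ 2 + δ ^ 2) ×ˢ ball x R) ∪
        Ioo (t - δ ^ 2) (t - δ ^ 2 + δ ^ 2) ×ˢ ball x R := by
  rintro ⟨s, y⟩ ⟨hs, hy⟩
  rw [mem_Ioo] at hs
  simp only [mem_union, mem_prod, mem_Ioo]
  have hδ : 0 ≤ δ ^ 2 := sq_nonneg δ
  rcases lt_or_ge s (t - δ ^ 2) with h | h
  · exact Or.inl (Or.inl ⟨⟨hs.1, by linarith⟩, hy⟩)
  · rcases lt_or_ge (t - δ ^ 2) s with h' | h'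
    · exact Or.inr ⟨⟨h', by linarith⟩, hy⟩
    · have : s = t - δ ^ 2 := le_antisymm h' h
      rcases (sq_nonneg δ).eq_or_lt with h0 | hpos
      · exact Or.inr ⟨⟨by linarith, by linarith⟩, hy⟩
      · exact Or.inl (Or.inr ⟨⟨by linarith, by linarith⟩, hy⟩)

/-- **Mass in a slab of length `2δ²`**: `∫∫_{(t-2δ², t) × B(x, R)} |F| ≤ 648 (R/δ)³ B δ^d` for
`0 < δ ≤ R`. [folklore] -/
theorem lintegral_slab_two_le_of_morrey {F : ℝ × ℝ³ → E'} {B d : ℝ} (hB : 0 ≤ B)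
    (hMor : ∀ (c : ℝ × ℝ³) (r : ℝ), 0 < r →
      ∫⁻ w in FluidPDE.parabolicCylinderCentered r c, ‖F w‖ₑ ≤ ENNReal.ofReal (B * r ^ d))
    {δ R : ℝ} (hδ : 0 < δ) (hδR : δ ≤ R) (t : ℝ) (x : ℝ³) :
    ∫⁻ w in Ioo (t - 2 * δ ^ 2) t ×ˢ ball x R, ‖F w‖ₑ ≤
      ENNReal.ofReal (648 * (R / δ) ^ 3 * B * δ ^ d) := by
  have hR : 0 < R := hδ.trans_le hδR
  have h := fun a => lintegral_slab_le_of_morrey (F := F) hB hMor hδ hδR a x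
  calc ∫⁻ w in Ioo (t - 2 * δ ^ 2) t ×ˢ ball x R, ‖F w‖ₑ
      ≤ ∫⁻ w in (Ioo (t - 2 * δ ^ 2) (t - 2 * δ ^ 2 + δ ^ 2) ×ˢ ball x R ∪
          Ioo (t - 3 / 2 * δ ^ 2) (t - 3 / 2 * δ ^ 2 + δ ^ 2) ×ˢ ball x R) ∪
          Ioo (t - δ ^ 2) (t - δ ^ 2 + δ ^ 2) ×ˢ ball x R, ‖F w‖ₑ :=
        lintegral_mono_set (slab_two_subset t δ R x)
    _ ≤ (∫⁻ w in Ioo (t - 2 * δ ^ 2) (t - 2 * δ ^ 2 + δ ^ 2) ×ˢ ball x R, ‖F w‖ₑ) +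
          (∫⁻ w in Ioo (t - 3 / 2 * δ ^ 2) (t - 3 / 2 * δ ^ 2 + δ ^ 2) ×ˢ ball x R, ‖F w‖ₑ) +
          ∫⁻ w in Ioo (t - δ ^ 2) (t - δ ^ 2 + δ ^ 2) ×ˢ ball x R, ‖F w‖ₑ :=
        (lintegral_union_le _ _ _).trans (add_le_add (lintegral_union_le _ _ _) le_rfl)
    _ ≤ ENNReal.ofReal (216 * (R / δ) ^ 3 * B * δ ^ d) + ENNReal.ofReal (216 * (R / δ) ^ 3 * B * δ ^ d) +
          ENNReal.ofReal (216 * (R / δ) ^ 3 * B * δ ^ d) := add_le_add (add_le_add (h _) (h _)) (h _)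
    _ = ENNReal.ofReal (648 * (R / δ) ^ 3 * B * δ ^ d) := by
        have h0 : 0 ≤ 216 * (R / δ) ^ 3 * B * δ ^ d := by positivity
        rw [← ENNReal.ofReal_add h0 h0, ← ENNReal.ofReal_add (by positivity) h0]
        congr 1
        ring

/-- **The slab-shell estimate**: for `m > 3` and data with `∫∫_{Q_r(c)} |F| ≤ B r^d`,
`∫_{t - 2δ² < s < t, |x - y| ≥ δ} |x - y|^{-m} |F(s, y)| ds dy ≤ 5184 (1 - 2^{3-m})⁻¹ B δ^{d-m}`
(shells `2ⁿδ ≤ |x - y| < 2ⁿ⁺¹δ`, on which `|x - y|^{-m} ≤ (2ⁿδ)^{-m}` and the slab mass is at most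
`648 · 2^{3(n+1)} B δ^d`). [folklore] -/
theorem lintegral_slab_shell_rpow_neg_mul_le {F : ℝ × ℝ³ → E'} {B d m δ : ℝ} (hB : 0 ≤ B)
    (hm : 3 < m) (hF : AEMeasurable (fun w => ‖F w‖ₑ) volume)
    (hMor : ∀ (c : ℝ × ℝ³) (r : ℝ), 0 < r →
      ∫⁻ w in FluidPDE.parabolicCylinderCentered r c, ‖F w‖ₑ ≤ ENNReal.ofReal (B * r ^ d))
    (t : ℝ) (x : ℝ³) (hδ : 0 < δ) :
    ∫⁻ w in {w : ℝ × ℝ³ | w.1 ∈ Ioo (t - 2 * δ ^ 2) t ∧ δ ≤ ‖x - w.2‖},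
        ENNReal.ofReal (‖x - w.2‖ ^ (-m)) * ‖F w‖ₑ ≤
      ENNReal.ofReal (5184 * (1 - (2 : ℝ) ^ (3 - m))⁻¹ * B * δ ^ (d - m)) := by
  -- radii, ratio, coefficients
  set s : ℕ → ℝ := fun n => δ * 2 ^ n with hs
  have hs0 : ∀ n, 0 < s n := fun n => by positivity
  set θ : ℝ := (2 : ℝ) ^ (3 - m) with hθ
  have hθ0 : 0 ≤ θ := by positivity
  have hθ1 : θ < 1 := Real.rpow_lt_one_of_one_lt_of_neg one_lt_two (by linarith)
  set a : ℕ → ℝ := fun n => s n ^ (-m) with ha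
  have ha0 : ∀ n, 0 ≤ a n := fun n => Real.rpow_nonneg (hs0 n).le _
  have hterm : ∀ n, a n * (648 * (2 * s n / δ) ^ 3 * B * δ ^ d) = 5184 * B * δ ^ (d - m) * θ ^ n := by
    intro n
    have hsn := hs0 n
    have h1 : (2 * s n / δ) ^ 3 = 8 * ((2 : ℝ) ^ n) ^ 3 := by
      rw [hs]
      simp only
      field_simp
      ring
    have h2 : a n = δ ^ (-m) * ((2 : ℝ) ^ (-m)) ^ n := by
      rw [ha, hs]
      simp only
      rw [Real.mul_rpow hδ.le (by positivity), ← Real.rpow_natCast (2 : ℝ) n,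
        ← Real.rpow_mul (by norm_num : (0 : ℝ) ≤ 2), mul_comm (n : ℝ) (-m),
        Real.rpow_mul (by norm_num : (0 : ℝ) ≤ 2), Real.rpow_natCast]
    have h3 : δ ^ (-m) * δ ^ d = δ ^ (d - m) := by
      rw [← Real.rpow_add hδ]
      congr 1
      ring
    have h4 : ((2 : ℝ) ^ (-m)) ^ n * ((2 : ℝ) ^ n) ^ 3 = θ ^ n := by
      have h8 : ((2 : ℝ) ^ n) ^ 3 = (8 : ℝ) ^ n := by
        rw [← pow_mul, mul_comm, pow_mul]
        norm_num
      rw [h8, hθ, Real.rpow_sub (by norm_num : (0 : ℝ) < 2), Real.rpow_neg (by norm_num : (0 : ℝ) ≤ 2),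
        show (2 : ℝ) ^ (3 : ℝ) = 8 by norm_num, div_pow, inv_pow]
      ring
    calc a n * (648 * (2 * s n / δ) ^ 3 * B * δ ^ d)
        = 5184 * B * (δ ^ (-m) * δ ^ d) * (((2 : ℝ) ^ (-m)) ^ n * ((2 : ℝ) ^ n) ^ 3) := by
          rw [h1, h2]; ring
      _ = 5184 * B * δ ^ (d - m) * θ ^ n := by rw [h3, h4]
  have hterm0 : ∀ n, 0 ≤ 5184 * B * δ ^ (d - m) * θ ^ n := fun n => by positivity
  have hsum : Summable fun n => 5184 * B * δ ^ (d - m) * θ ^ n :=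
    (summable_geometric_of_lt_one hθ0 hθ1).mul_left _
  have htsum : ∑' n, 5184 * B * δ ^ (d - m) * θ ^ n = 5184 * (1 - θ)⁻¹ * B * δ ^ (d - m) := by
    rw [tsum_mul_left, tsum_geometric_of_lt_one hθ0 hθ1]
    ring
  -- the sets of the decomposition
  set T : ℕ → Set (ℝ × ℝ³) := fun n => Ioo (t - 2 * δ ^ 2) t ×ˢ ball x (2 * s n) with hT
  have hTm : ∀ n, MeasurableSet (T n) := fun n => measurableSet_Ioo.prod measurableSet_ball
  set S : Set (ℝ × ℝ³) := {w : ℝ × ℝ³ | w.1 ∈ Ioo (t - 2 * δ ^ 2) t ∧ δ ≤ ‖x - w.2‖} with hS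
  have hSm : MeasurableSet S := by
    have h1 : MeasurableSet {w : ℝ × ℝ³ | w.1 ∈ Ioo (t - 2 * δ ^ 2) t} :=
      measurable_fst measurableSet_Ioo
    have h2 : MeasurableSet {w : ℝ × ℝ³ | δ ≤ ‖x - w.2‖} :=
      measurableSet_le measurable_const ((measurable_const.sub measurable_snd).norm)
    exact h1.inter h2
  -- the pointwise dyadic bound on `S`
  have hpt : ∀ w ∈ S, ENNReal.ofReal (‖x - w.2‖ ^ (-m)) ≤
      ∑' n, ENNReal.ofReal (a n) * (T n).indicator 1 w := by
    rintro ⟨σ, y⟩ ⟨hσ, hy⟩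
    simp only at hσ hy ⊢
    set ρ := ‖x - y‖ with hρ
    have hpos : 0 < ρ := hδ.trans_le hy
    have hx : 1 ≤ ρ / δ := by rw [le_div_iff₀ hδ]; linarith
    obtain ⟨n, hn1, hn2⟩ := exists_nat_pow_near hx one_lt_two
    have hρge : s n ≤ ρ := by
      rw [hs]
      simp only
      rw [le_div_iff₀ hδ] at hn1
      linarith
    have hρlt : ρ < 2 * s n := by
      rw [hs]
      simp only
      rw [div_lt_iff₀ hδ, pow_succ] at hn2
      linarith
    have hmem : ((σ, y) : ℝ × ℝ³) ∈ T n := by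
      refine ⟨hσ, ?_⟩
      rw [mem_ball, dist_eq_norm, ← norm_neg, neg_sub, ← hρ]
      exact hρlt
    refine le_trans ?_ (ENNReal.le_tsum n)
    rw [indicator_of_mem hmem, Pi.one_apply, mul_one]
    exact ENNReal.ofReal_le_ofReal (Real.rpow_le_rpow_of_nonpos (hs0 n) hρge (by linarith))
  calc ∫⁻ w in S, ENNReal.ofReal (‖x - w.2‖ ^ (-m)) * ‖F w‖ₑ
      ≤ ∫⁻ w in S, (∑' n, ENNReal.ofReal (a n) * (T n).indicator 1 w) * ‖F w‖ₑ :=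
        setLIntegral_mono' hSm fun w hw => mul_le_mul' (hpt w hw) le_rfl
    _ ≤ ∫⁻ w, (∑' n, ENNReal.ofReal (a n) * (T n).indicator 1 w) * ‖F w‖ₑ :=
        setLIntegral_le_lintegral _ _
    _ = ∫⁻ w, ∑' n, ENNReal.ofReal (a n) * (T n).indicator (fun w => ‖F w‖ₑ) w := by
        congr 1
        funext w
        rw [← ENNReal.tsum_mul_right]
        congr 1
        funext n
        rw [mul_assoc]
        congr 1
        by_cases hw : w ∈ T n
        · simp [indicator_of_mem hw]
        · simp [indicator_of_notMem hw]
    _ = ∑' n, ∫⁻ w, ENNReal.ofReal (a n) * (T n).indicator (fun w => ‖F w‖ₑ) w :=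
        lintegral_tsum fun n => (hF.indicator (hTm n)).const_mul _
    _ = ∑' n, ENNReal.ofReal (a n) * ∫⁻ w in T n, ‖F w‖ₑ := by
        congr 1
        funext n
        rw [lintegral_const_mul'' _ (hF.indicator (hTm n)), lintegral_indicator (hTm n)]
    _ ≤ ∑' n, ENNReal.ofReal (a n) * ENNReal.ofReal (648 * (2 * s n / δ) ^ 3 * B * δ ^ d) := by
        refine ENNReal.tsum_le_tsum fun n => mul_le_mul' le_rfl ?_
        have hR : δ ≤ 2 * s n := by
          rw [hs]
          simp only
          have : (1 : ℝ) ≤ 2 ^ n := one_le_pow₀ (by norm_num)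
          nlinarith
        exact lintegral_slab_two_le_of_morrey hB hMor hδ hR t x
    _ = ∑' n, ENNReal.ofReal (5184 * B * δ ^ (d - m) * θ ^ n) := by
        congr 1
        funext n
        rw [← ENNReal.ofReal_mul (ha0 n), hterm n]
    _ = ENNReal.ofReal (∑' n, 5184 * B * δ ^ (d - m) * θ ^ n) :=
        (ENNReal.ofReal_tsum_of_nonneg hterm0 hsum).symm
    _ = ENNReal.ofReal (5184 * (1 - (2 : ℝ) ^ (3 - m))⁻¹ * B * δ ^ (d - m)) := by rw [htsum]

end SlabShell

/-! ### The Hölder estimate for forward kernels -/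

section Holder

/-- The constant of `parabolicHolderOnWith_integral_of_kernel_bounds_fwd`. [folklore] -/
def kernelHolderConstFwd (A B m d : ℝ) : ℝ :=
  A * B * (2 ^ d * 2 ^ m * (1 - ((2 : ℝ) ^ (d - m))⁻¹)⁻¹ * ((4 : ℝ) ^ (d - m) + (5 : ℝ) ^ (d - m)) +
    2 ^ d * (1 - (2 : ℝ) ^ (d - m - 1))⁻¹ * (4 : ℝ) ^ (d - m - 1) +
    2 * (5184 * (1 - (2 : ℝ) ^ (3 - m))⁻¹))

/-- A kernel with `|K(z)| ρ₂(z)^m ≤ A` (`m > 0`) is bounded by `A |z.2|^{-m}` wherever `z.2 ≠ 0`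
(`ρ₂(z) ≥ |z.2|`). [folklore] -/
theorem norm_le_mul_norm_snd_rpow_neg {K : ℝ × ℝ³ → ℂ} {A m : ℝ} (hm : 0 < m)
    (hK1 : ∀ z, ‖K z‖ * parabolicNorm z ^ m ≤ A) {z : ℝ × ℝ³} (hz : z.2 ≠ 0) :
    ‖K z‖ ≤ A * ‖z.2‖ ^ (-m) := by
  have hy : 0 < ‖z.2‖ := norm_pos_iff.2 hz
  have hρy : ‖z.2‖ ≤ parabolicNorm z := by
    unfold parabolicNorm
    have : 0 ≤ Real.sqrt |z.1| := Real.sqrt_nonneg _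
    linarith
  have hρ : 0 < parabolicNorm z := hy.trans_le hρy
  have hA : 0 ≤ A :=
    le_trans (mul_nonneg (norm_nonneg _) (Real.rpow_nonneg hρ.le m)) (hK1 z)
  calc ‖K z‖ ≤ A * parabolicNorm z ^ (-m) := by
        rw [Real.rpow_neg hρ.le, ← div_eq_mul_inv, le_div_iff₀ (Real.rpow_pos_of_pos hρ _)]
        exact hK1 z
    _ ≤ A * ‖z.2‖ ^ (-m) :=
        mul_le_mul_of_nonneg_left (Real.rpow_le_rpow_of_nonpos hy hρy (by linarith)) hA

/-- **Hölder continuity of forward parabolic singular potentials of Morrey data** (the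
real-variable scheme behind the `σ(D)g`-part of Lemarié-Rieusset 2016, Prop. 13.4, p. 465, with
the thin-slab correction). Let `K : ℝ × ℝ³ → ℂ` be measurable, vanishing for `t ≤ 0`, with
`|K(z)| ρ₂(z)^m ≤ A` for all `z` and `|K(z) - K(z - z')| ρ₂(z)^{m+1} ≤ A ρ₂(z')` whenever
`2ρ₂(z') ≤ ρ₂(z)`, `ρ₂(z')² ≤ z.1` and `ρ₂(z')² ≤ z.1 - z'.1`; let `F` be measurable with
`∫∫_{Q_r(c)} |F| ≤ B r^d`, where `3 < m < d < m + 1`; assume `w ↦ K(z - w)F(w)` integrable for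
every `z`. Then `h(z) = ∫ K(z - w) F(w) dw` satisfies `|h(z₁) - h(z₂)| ≤ C ρ₂(z₁ - z₂)^{d-m}` on
`ℝ × ℝ³` with `C = kernelHolderConstFwd A B m d`. With `δ = ρ₂(z₁ - z₂)`: on `ρ₂(z₁ - w) < 4δ` the
size bound and `lintegral_parabolicBall_rpow_neg_mul_le` (radii `4δ`, `5δ`); on
`ρ₂(z₁ - w) ≥ 4δ` and `s ≤ min(t₁, t₂) - δ²` the regularity bound and
`lintegral_compl_parabolicBall_rpow_neg_mul_le`; on `ρ₂(z₁ - w) ≥ 4δ` and `s > min(t₁,t₂) - δ²`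
each kernel `K(zᵢ - w)` lives on `tᵢ - 2δ² < s < tᵢ`, `|xᵢ - y| ≥ δ`, is at most `A|xᵢ - y|^{-m}`,
and `lintegral_slab_shell_rpow_neg_mul_le` applies. [cite: LemarieRieusset2016, Prop. 13.4 proof p. 465] -/
theorem parabolicHolderOnWith_integral_of_kernel_bounds_fwd {K F : ℝ × ℝ³ → ℂ} {A B m d : ℝ}
    (hK : Measurable K) (hF : Measurable F) (hB : 0 ≤ B) (hm : 3 < m) (hmd : m < d)
    (hdm : d < m + 1) (hK0 : ∀ z : ℝ × ℝ³, z.1 ≤ 0 → K z = 0)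
    (hK1 : ∀ z, ‖K z‖ * parabolicNorm z ^ m ≤ A)
    (hK2 : ∀ z z' : ℝ × ℝ³, 2 * parabolicNorm z' ≤ parabolicNorm z →
      parabolicNorm z' ^ 2 ≤ z.1 → parabolicNorm z' ^ 2 ≤ z.1 - z'.1 →
      ‖K z - K (z - z')‖ * parabolicNorm z ^ (m + 1) ≤ A * parabolicNorm z')
    (hMor : ∀ (c : ℝ × ℝ³) (r : ℝ), 0 < r →
      ∫⁻ w in FluidPDE.parabolicCylinderCentered r c, ‖F w‖ₑ ≤ ENNReal.ofReal (B * r ^ d))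
    (hint : ∀ z, Integrable (fun w => K (z - w) * F w)) :
    ParabolicHolderOnWith (kernelHolderConstFwd A B m d) (d - m) (fun z => ∫ w, K (z - w) * F w)
      univ := by
  have hm0 : 0 < m := by linarith
  have hA : 0 ≤ A :=
    le_trans (mul_nonneg (norm_nonneg _) (Real.rpow_nonneg (parabolicNorm_nonneg _) m)) (hK1 0)
  have hK00 : K 0 = 0 := hK0 0 le_rfl
  -- the constants
  set C₁ : ℝ := 2 ^ d * 2 ^ m * (1 - ((2 : ℝ) ^ (d - m))⁻¹)⁻¹ with hC₁
  set C₂ : ℝ := 2 ^ d * (1 - (2 : ℝ) ^ (d - m - 1))⁻¹ with hC₂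
  set C₃ : ℝ := 5184 * (1 - (2 : ℝ) ^ (3 - m))⁻¹ with hC₃
  have h2dm : 1 < (2 : ℝ) ^ (d - m) := Real.one_lt_rpow one_lt_two (by linarith)
  have hC₁0 : 0 ≤ C₁ := by
    have : 0 < 1 - ((2 : ℝ) ^ (d - m))⁻¹ := sub_pos.2 (inv_lt_one_of_one_lt₀ h2dm)
    positivity
  have hC₂0 : 0 ≤ C₂ := by
    have : 0 < 1 - (2 : ℝ) ^ (d - m - 1) :=
      sub_pos.2 (Real.rpow_lt_one_of_one_lt_of_neg one_lt_two (by linarith))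
    positivity
  have hC₃0 : 0 ≤ C₃ := by
    have : 0 < 1 - (2 : ℝ) ^ (3 - m) :=
      sub_pos.2 (Real.rpow_lt_one_of_one_lt_of_neg one_lt_two (by linarith))
    positivity
  have hC0 : 0 ≤ kernelHolderConstFwd A B m d := by
    unfold kernelHolderConstFwd
    rw [← hC₁, ← hC₂, ← hC₃]
    positivity
  have hFm : AEMeasurable (fun w => ‖F w‖ₑ) volume := hF.enorm.aemeasurable
  intro z₁ _ z₂ _
  rw [parabolicDist_eq_parabolicNorm]
  set δ : ℝ := parabolicNorm (z₁ - z₂) with hδ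
  rcases (parabolicNorm_nonneg (z₁ - z₂)).eq_or_lt with h0 | hδ0
  · have h12 : z₁ = z₂ := sub_eq_zero.1 ((parabolicNorm_eq_zero_iff _).1 h0.symm)
    subst h12
    simp only [sub_self, norm_zero]
    positivity
  rw [← hδ] at hδ0
  -- components of the two points
  set t₁ : ℝ := z₁.1 with ht₁
  set t₂ : ℝ := z₂.1 with ht₂
  set x₁ : ℝ³ := z₁.2 with hx₁
  set x₂ : ℝ³ := z₂.2 with hx₂
  have htt : |t₁ - t₂| ≤ δ ^ 2 := abs_le_parabolicNorm_sq (z₁ - z₂).1 (z₁ - z₂).2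
  -- the difference of the potentials as one integral
  have hsub : (∫ w, K (z₁ - w) * F w) - ∫ w, K (z₂ - w) * F w =
      ∫ w, (K (z₁ - w) - K (z₂ - w)) * F w := by
    rw [← integral_sub (hint z₁) (hint z₂)]
    congr 1
    funext w
    ring
  rw [hsub]
  refine (norm_integral_le_lintegral_norm _).trans
    (ENNReal.toReal_le_of_le_ofReal (by positivity) ?_)
  -- the near region
  set N : Set (ℝ × ℝ³) := parabolicBall z₁ (4 * δ) with hN
  have hNm : MeasurableSet N := measurableSet_parabolicBall _ _
  have hG : ∀ w, ENNReal.ofReal ‖(K (z₁ - w) - K (z₂ - w)) * F w‖ =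
      ‖K (z₁ - w) - K (z₂ - w)‖ₑ * ‖F w‖ₑ := fun w => by
    rw [ofReal_norm, enorm_mul]
  simp_rw [hG]
  rw [← lintegral_add_compl _ hNm]
  -- near part
  have hnear : ∫⁻ w in N, ‖K (z₁ - w) - K (z₂ - w)‖ₑ * ‖F w‖ₑ ≤
      ENNReal.ofReal (A * (C₁ * B * (4 * δ) ^ (d - m))) +
        ENNReal.ofReal (A * (C₁ * B * (5 * δ) ^ (d - m))) := by
    have hKb : ∀ v : ℝ × ℝ³, ‖K v‖ₑ ≤
        ENNReal.ofReal A * ENNReal.ofReal (parabolicNorm v ^ (-m)) := fun v =>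
      enorm_le_of_mul_rpow_le hK00 hK1 v
    have hK₁ : ∀ w, ‖K (z₁ - w)‖ₑ * ‖F w‖ₑ ≤
        ENNReal.ofReal A * (ENNReal.ofReal (parabolicNorm (z₁ - w) ^ (-m)) * ‖F w‖ₑ) :=
      fun w => by rw [← mul_assoc]; exact mul_le_mul' (hKb _) le_rfl
    have hK₂ : ∀ w, ‖K (z₂ - w)‖ₑ * ‖F w‖ₑ ≤
        ENNReal.ofReal A * (ENNReal.ofReal (parabolicNorm (z₂ - w) ^ (-m)) * ‖F w‖ₑ) :=
      fun w => by rw [← mul_assoc]; exact mul_le_mul' (hKb _) le_rfl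
    have hNsub : N ⊆ parabolicBall z₂ (5 * δ) := by
      intro w hw
      rw [hN, mem_parabolicBall] at hw
      rw [mem_parabolicBall]
      calc parabolicNorm (z₂ - w) ≤ parabolicNorm (z₂ - z₁) + parabolicNorm (z₁ - w) :=
            parabolicNorm_sub_le _ _ _
        _ < δ + 4 * δ := by rw [parabolicNorm_sub_comm, ← hδ]; linarith
        _ = 5 * δ := by ring
    have hmeas₁ : Measurable fun w => ‖K (z₁ - w)‖ₑ * ‖F w‖ₑ :=
      (hK.comp (measurable_const.sub measurable_id)).enorm.mul hF.enorm
    calc ∫⁻ w in N, ‖K (z₁ - w) - K (z₂ - w)‖ₑ * ‖F w‖ₑ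
        ≤ ∫⁻ w in N, (‖K (z₁ - w)‖ₑ * ‖F w‖ₑ + ‖K (z₂ - w)‖ₑ * ‖F w‖ₑ) := by
          refine lintegral_mono fun w => ?_
          rw [← add_mul]
          exact mul_le_mul' enorm_sub_le le_rfl
      _ = (∫⁻ w in N, ‖K (z₁ - w)‖ₑ * ‖F w‖ₑ) + ∫⁻ w in N, ‖K (z₂ - w)‖ₑ * ‖F w‖ₑ :=
          lintegral_add_left hmeas₁ _
      _ ≤ (∫⁻ w in N, ENNReal.ofReal A *
              (ENNReal.ofReal (parabolicNorm (z₁ - w) ^ (-m)) * ‖F w‖ₑ)) +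
            ∫⁻ w in parabolicBall z₂ (5 * δ), ENNReal.ofReal A *
              (ENNReal.ofReal (parabolicNorm (z₂ - w) ^ (-m)) * ‖F w‖ₑ) :=
          add_le_add (lintegral_mono fun w => hK₁ w)
            ((lintegral_mono_set hNsub).trans (lintegral_mono fun w => hK₂ w))
      _ = ENNReal.ofReal A *
              (∫⁻ w in N, ENNReal.ofReal (parabolicNorm (z₁ - w) ^ (-m)) * ‖F w‖ₑ) +
            ENNReal.ofReal A * ∫⁻ w in parabolicBall z₂ (5 * δ),
              ENNReal.ofReal (parabolicNorm (z₂ - w) ^ (-m)) * ‖F w‖ₑ := by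
          rw [lintegral_const_mul' _ _ ENNReal.ofReal_ne_top,
            lintegral_const_mul' _ _ ENNReal.ofReal_ne_top]
      _ ≤ ENNReal.ofReal A * ENNReal.ofReal (C₁ * B * (4 * δ) ^ (d - m)) +
            ENNReal.ofReal A * ENNReal.ofReal (C₁ * B * (5 * δ) ^ (d - m)) := by
          gcongr
          · exact lintegral_parabolicBall_rpow_neg_mul_le hB hm0 hmd hFm hMor z₁ (by linarith)
          · exact lintegral_parabolicBall_rpow_neg_mul_le hB hm0 hmd hFm hMor z₂ (by linarith)
      _ = ENNReal.ofReal (A * (C₁ * B * (4 * δ) ^ (d - m))) +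
            ENNReal.ofReal (A * (C₁ * B * (5 * δ) ^ (d - m))) := by
          rw [← ENNReal.ofReal_mul hA, ← ENNReal.ofReal_mul hA]
  -- the two slabs
  set S₁ : Set (ℝ × ℝ³) := {w : ℝ × ℝ³ | w.1 ∈ Ioo (t₁ - 2 * δ ^ 2) t₁ ∧ δ ≤ ‖x₁ - w.2‖} with hS₁
  set S₂ : Set (ℝ × ℝ³) := {w : ℝ × ℝ³ | w.1 ∈ Ioo (t₂ - 2 * δ ^ 2) t₂ ∧ δ ≤ ‖x₂ - w.2‖} with hS₂
  have hSm : ∀ (t : ℝ) (x : ℝ³),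
      MeasurableSet {w : ℝ × ℝ³ | w.1 ∈ Ioo (t - 2 * δ ^ 2) t ∧ δ ≤ ‖x - w.2‖} := by
    intro t x
    have h1 : MeasurableSet {w : ℝ × ℝ³ | w.1 ∈ Ioo (t - 2 * δ ^ 2) t} :=
      measurable_fst measurableSet_Ioo
    have h2 : MeasurableSet {w : ℝ × ℝ³ | δ ≤ ‖x - w.2‖} :=
      measurableSet_le measurable_const ((measurable_const.sub measurable_snd).norm)
    exact h1.inter h2
  have hS₁m : MeasurableSet S₁ := hSm t₁ x₁
  have hS₂m : MeasurableSet S₂ := hSm t₂ x₂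
  set f₁ : ℝ × ℝ³ → ℝ≥0∞ := fun w => ENNReal.ofReal (‖x₁ - w.2‖ ^ (-m)) * ‖F w‖ₑ with hf₁
  set f₂ : ℝ × ℝ³ → ℝ≥0∞ := fun w => ENNReal.ofReal (‖x₂ - w.2‖ ^ (-m)) * ‖F w‖ₑ with hf₂
  have hfm : ∀ x : ℝ³, Measurable fun w : ℝ × ℝ³ => ENNReal.ofReal (‖x - w.2‖ ^ (-m)) * ‖F w‖ₑ :=
    fun x => (ENNReal.measurable_ofReal.comp
      (((measurable_const.sub measurable_snd).norm).pow_const _)).mul hF.enorm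
  have hf₁m : Measurable f₁ := hfm x₁
  have hf₂m : Measurable f₂ := hfm x₂
  -- the kernel `K (zᵢ - w)` on the slab, off the near region
  have hslab : ∀ zi : ℝ × ℝ³, (∀ w, w ∉ N → 3 * δ ≤ parabolicNorm (zi - w)) →
      zi.1 - δ ^ 2 ≤ min t₁ t₂ →
      ∀ w, w ∉ N → min t₁ t₂ - δ ^ 2 < w.1 →
        ‖K (zi - w)‖ₑ * ‖F w‖ₑ ≤ ENNReal.ofReal A *
          {w : ℝ × ℝ³ | w.1 ∈ Ioo (zi.1 - 2 * δ ^ 2) zi.1 ∧ δ ≤ ‖zi.2 - w.2‖}.indicator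
            (fun w => ENNReal.ofReal (‖zi.2 - w.2‖ ^ (-m)) * ‖F w‖ₑ) w := by
    intro zi hρ3 hmin w hwN hws
    by_cases hKw : K (zi - w) = 0
    · rw [hKw]
      simp
    have hτpos : 0 < (zi - w).1 := lt_of_not_ge fun h => hKw (hK0 _ h)
    have hfst : (zi - w).1 = zi.1 - w.1 := rfl
    have hlow : zi.1 - 2 * δ ^ 2 < w.1 := by linarith
    have hup : w.1 < zi.1 := by linarith
    have hτlt : (zi - w).1 < (2 * δ) ^ 2 := by nlinarith
    have hsqrt : Real.sqrt ((zi - w).1) < 2 * δ := by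
      rw [Real.sqrt_lt' (by linarith)]
      exact hτlt
    have hρeq : parabolicNorm (zi - w) = Real.sqrt ((zi - w).1) + ‖zi.2 - w.2‖ := by
      have := parabolicNorm_mk_of_nonneg hτpos.le (zi - w).2
      rw [Prod.mk.eta] at this
      rw [this]
      rfl
    have hspace : δ ≤ ‖zi.2 - w.2‖ := by
      have := hρ3 w hwN
      linarith
    have hne : (zi - w).2 ≠ 0 := by
      intro h0
      have : ‖zi.2 - w.2‖ = 0 := by rw [show zi.2 - w.2 = (zi - w).2 from rfl, h0, norm_zero]
      linarith
    have hmem : w ∈ {w : ℝ × ℝ³ | w.1 ∈ Ioo (zi.1 - 2 * δ ^ 2) zi.1 ∧ δ ≤ ‖zi.2 - w.2‖} :=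
      ⟨⟨hlow, hup⟩, hspace⟩
    rw [indicator_of_mem hmem, ← mul_assoc]
    refine mul_le_mul' ?_ le_rfl
    have hKn : ‖K (zi - w)‖ ≤ A * ‖(zi - w).2‖ ^ (-m) := norm_le_mul_norm_snd_rpow_neg hm0 hK1 hne
    rw [← ofReal_norm, ← ENNReal.ofReal_mul hA]
    exact ENNReal.ofReal_le_ofReal hKn
  have httabs := abs_le.1 htt
  have h₁cond : z₁.1 - δ ^ 2 ≤ min t₁ t₂ := le_min (by rw [← ht₁]; nlinarith [sq_nonneg δ]) (by rw [← ht₁]; linarith)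
  have h₂cond : z₂.1 - δ ^ 2 ≤ min t₁ t₂ := le_min (by rw [← ht₂]; linarith) (by rw [← ht₂]; nlinarith [sq_nonneg δ])
  have h₁far : ∀ w, w ∉ N → 3 * δ ≤ parabolicNorm (z₁ - w) := by
    intro w hw
    rw [hN, mem_parabolicBall, not_lt] at hw
    linarith
  have h₂far : ∀ w, w ∉ N → 3 * δ ≤ parabolicNorm (z₂ - w) := by
    intro w hw
    rw [hN, mem_parabolicBall, not_lt] at hw
    have := parabolicNorm_sub_le z₁ z₂ w
    rw [← hδ] at this
    linarith
  -- far part, pointwise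
  have hfar_pt : ∀ w ∈ Nᶜ, ‖K (z₁ - w) - K (z₂ - w)‖ₑ * ‖F w‖ₑ ≤
      ENNReal.ofReal (A * δ) * (ENNReal.ofReal (parabolicNorm (z₁ - w) ^ (-(m + 1))) * ‖F w‖ₑ) +
        ENNReal.ofReal A * S₁.indicator f₁ w + ENNReal.ofReal A * S₂.indicator f₂ w := by
    intro w hw
    have hwN : w ∉ N := hw
    rw [hN, mem_compl_iff, mem_parabolicBall, not_lt] at hw
    rcases le_or_gt w.1 (min t₁ t₂ - δ ^ 2) with hws | hws
    · -- both times at least `δ²`: regularity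
      have hρ : 0 < parabolicNorm (z₁ - w) := by linarith
      have hc1 : δ ^ 2 ≤ (z₁ - w).1 := by
        have : (z₁ - w).1 = t₁ - w.1 := rfl
        have : min t₁ t₂ ≤ t₁ := min_le_left _ _
        linarith
      have hc2 : δ ^ 2 ≤ (z₁ - w).1 - (z₁ - z₂).1 := by
        have : (z₁ - w).1 - (z₁ - z₂).1 = t₂ - w.1 := by
          rw [ht₂]; simp only [Prod.fst_sub]; ring
        have : min t₁ t₂ ≤ t₂ := min_le_right _ _
        linarith
      have h1 := hK2 (z₁ - w) (z₁ - z₂) (by rw [← hδ]; linarith) (by rw [← hδ]; exact hc1)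
        (by rw [← hδ]; exact hc2)
      rw [show z₁ - w - (z₁ - z₂) = z₂ - w by abel, ← hδ] at h1
      have h2 : ‖K (z₁ - w) - K (z₂ - w)‖ ≤ A * δ * parabolicNorm (z₁ - w) ^ (-(m + 1)) := by
        rw [Real.rpow_neg hρ.le, ← div_eq_mul_inv, le_div_iff₀ (Real.rpow_pos_of_pos hρ _)]
        exact h1
      refine le_trans ?_ (le_add_right (le_add_right le_rfl))
      rw [← mul_assoc]
      refine mul_le_mul' ?_ le_rfl
      rw [← ofReal_norm, ← ENNReal.ofReal_mul (by positivity)]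
      exact ENNReal.ofReal_le_ofReal h2
    · -- the slab: the two kernels separately
      have h₁ := hslab z₁ h₁far h₁cond w hwN hws
      have h₂ := hslab z₂ h₂far h₂cond w hwN hws
      calc ‖K (z₁ - w) - K (z₂ - w)‖ₑ * ‖F w‖ₑ
          ≤ (‖K (z₁ - w)‖ₑ + ‖K (z₂ - w)‖ₑ) * ‖F w‖ₑ := mul_le_mul' enorm_sub_le le_rfl
        _ = ‖K (z₁ - w)‖ₑ * ‖F w‖ₑ + ‖K (z₂ - w)‖ₑ * ‖F w‖ₑ := add_mul _ _ _
        _ ≤ ENNReal.ofReal A * S₁.indicator f₁ w + ENNReal.ofReal A * S₂.indicator f₂ w :=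
            add_le_add h₁ h₂
        _ ≤ _ := by rw [add_assoc]; exact le_add_left le_rfl
  -- far part, integrated
  have hfar : ∫⁻ w in Nᶜ, ‖K (z₁ - w) - K (z₂ - w)‖ₑ * ‖F w‖ₑ ≤
      ENNReal.ofReal (A * δ * (C₂ * B * (4 * δ) ^ (d - m - 1))) +
        ENNReal.ofReal (A * (C₃ * B * δ ^ (d - m))) + ENNReal.ofReal (A * (C₃ * B * δ ^ (d - m))) := by
    have hmeasA : Measurable fun w => ENNReal.ofReal (A * δ) *
        (ENNReal.ofReal (parabolicNorm (z₁ - w) ^ (-(m + 1))) * ‖F w‖ₑ) :=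
      ((ENNReal.measurable_ofReal.comp ((continuous_parabolicNorm.measurable.comp
        (measurable_const.sub measurable_id)).pow_const _)).mul hF.enorm).const_mul _
    have hmeasB : Measurable fun w => ENNReal.ofReal A * S₁.indicator f₁ w :=
      (hf₁m.indicator hS₁m).const_mul _
    have hmeasAB : Measurable fun w => ENNReal.ofReal (A * δ) *
        (ENNReal.ofReal (parabolicNorm (z₁ - w) ^ (-(m + 1))) * ‖F w‖ₑ) +
          ENNReal.ofReal A * S₁.indicator f₁ w := hmeasA.add hmeasB
    calc ∫⁻ w in Nᶜ, ‖K (z₁ - w) - K (z₂ - w)‖ₑ * ‖F w‖ₑ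
        ≤ ∫⁻ w in Nᶜ, (ENNReal.ofReal (A * δ) *
              (ENNReal.ofReal (parabolicNorm (z₁ - w) ^ (-(m + 1))) * ‖F w‖ₑ) +
            ENNReal.ofReal A * S₁.indicator f₁ w + ENNReal.ofReal A * S₂.indicator f₂ w) :=
          setLIntegral_mono' hNm.compl hfar_pt
      _ = (∫⁻ w in Nᶜ, ENNReal.ofReal (A * δ) *
              (ENNReal.ofReal (parabolicNorm (z₁ - w) ^ (-(m + 1))) * ‖F w‖ₑ)) +
            (∫⁻ w in Nᶜ, ENNReal.ofReal A * S₁.indicator f₁ w) +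
            ∫⁻ w in Nᶜ, ENNReal.ofReal A * S₂.indicator f₂ w := by
          rw [lintegral_add_left hmeasAB, lintegral_add_left hmeasA]
      _ = ENNReal.ofReal (A * δ) * (∫⁻ w in Nᶜ,
              ENNReal.ofReal (parabolicNorm (z₁ - w) ^ (-(m + 1))) * ‖F w‖ₑ) +
            ENNReal.ofReal A * (∫⁻ w in Nᶜ, S₁.indicator f₁ w) +
            ENNReal.ofReal A * ∫⁻ w in Nᶜ, S₂.indicator f₂ w := by
          rw [lintegral_const_mul' _ _ ENNReal.ofReal_ne_top,
            lintegral_const_mul' _ _ ENNReal.ofReal_ne_top,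
            lintegral_const_mul' _ _ ENNReal.ofReal_ne_top]
      _ ≤ ENNReal.ofReal (A * δ) * ENNReal.ofReal (C₂ * B * (4 * δ) ^ (d - m - 1)) +
            ENNReal.ofReal A * ENNReal.ofReal (C₃ * B * δ ^ (d - m)) +
            ENNReal.ofReal A * ENNReal.ofReal (C₃ * B * δ ^ (d - m)) := by
          gcongr
          · exact lintegral_compl_parabolicBall_rpow_neg_mul_le hB hm0 hdm hFm hMor z₁ (by linarith)
          · calc ∫⁻ w in Nᶜ, S₁.indicator f₁ w ≤ ∫⁻ w, S₁.indicator f₁ w :=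
                  setLIntegral_le_lintegral _ _
              _ = ∫⁻ w in S₁, f₁ w := lintegral_indicator hS₁m _
              _ ≤ ENNReal.ofReal (C₃ * B * δ ^ (d - m)) :=
                  lintegral_slab_shell_rpow_neg_mul_le hB hm hFm hMor t₁ x₁ hδ0
          · calc ∫⁻ w in Nᶜ, S₂.indicator f₂ w ≤ ∫⁻ w, S₂.indicator f₂ w :=
                  setLIntegral_le_lintegral _ _
              _ = ∫⁻ w in S₂, f₂ w := lintegral_indicator hS₂m _
              _ ≤ ENNReal.ofReal (C₃ * B * δ ^ (d - m)) :=
                  lintegral_slab_shell_rpow_neg_mul_le hB hm hFm hMor t₂ x₂ hδ0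
      _ = ENNReal.ofReal (A * δ * (C₂ * B * (4 * δ) ^ (d - m - 1))) +
            ENNReal.ofReal (A * (C₃ * B * δ ^ (d - m))) +
            ENNReal.ofReal (A * (C₃ * B * δ ^ (d - m))) := by
          rw [← ENNReal.ofReal_mul (by positivity), ← ENNReal.ofReal_mul hA]
  -- conclusion
  refine (add_le_add hnear hfar).trans (le_of_eq ?_)
  have hp1 : 0 ≤ A * (C₁ * B * (4 * δ) ^ (d - m)) := by positivity
  have hp2 : 0 ≤ A * (C₁ * B * (5 * δ) ^ (d - m)) := by positivity
  have hp3 : 0 ≤ A * δ * (C₂ * B * (4 * δ) ^ (d - m - 1)) := by positivity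
  have hp4 : 0 ≤ A * (C₃ * B * δ ^ (d - m)) := by positivity
  rw [← ENNReal.ofReal_add hp1 hp2, ← ENNReal.ofReal_add hp3 hp4,
    ← ENNReal.ofReal_add (by positivity) hp4, ← ENNReal.ofReal_add (by positivity) (by positivity)]
  congr 1
  have h4δ : (4 * δ) ^ (d - m) = (4 : ℝ) ^ (d - m) * δ ^ (d - m) :=
    Real.mul_rpow (by norm_num) hδ0.le
  have h5δ : (5 * δ) ^ (d - m) = (5 : ℝ) ^ (d - m) * δ ^ (d - m) :=
    Real.mul_rpow (by norm_num) hδ0.le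
  have h4δ' : δ * (4 * δ) ^ (d - m - 1) = (4 : ℝ) ^ (d - m - 1) * δ ^ (d - m) := by
    rw [Real.mul_rpow (by norm_num) hδ0.le]
    have : δ * δ ^ (d - m - 1) = δ ^ (d - m) := by
      conv_lhs => rw [show δ = δ ^ (1 : ℝ) by rw [Real.rpow_one]]
      rw [← Real.rpow_mul hδ0.le, one_mul, ← Real.rpow_add hδ0]
      congr 1
      ring
    calc δ * ((4 : ℝ) ^ (d - m - 1) * δ ^ (d - m - 1))
        = (4 : ℝ) ^ (d - m - 1) * (δ * δ ^ (d - m - 1)) := by ring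
      _ = (4 : ℝ) ^ (d - m - 1) * δ ^ (d - m) := by rw [this]
  have hre : A * δ * (C₂ * B * (4 * δ) ^ (d - m - 1)) =
      A * C₂ * B * (δ * (4 * δ) ^ (d - m - 1)) := by ring
  rw [h4δ, h5δ, hre, h4δ']
  unfold kernelHolderConstFwd
  rw [← hC₁, ← hC₂, ← hC₃]
  ring

end Holder

/-! ### Absolute convergence of forward potentials of time-cut Morrey data -/

/-- **Absolute convergence of forward singular potentials of time-cut Morrey data**: for a
measurable kernel `K` vanishing for `t ≤ 0` with `|K(z)| ρ₂(z)^m ≤ A`, `3 < m < d`, and measurable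
data `F` vanishing for `s ≤ T` with `∫∫_{Q_r(c)} |F| ≤ B r^d`, the function `w ↦ K(z - w) F(w)`
is integrable for every `z`: near the pole by `lintegral_parabolicBall_rpow_neg_mul_le`
(`m < d`); far from it the integrand lives on the slab `T < s < t` where, with
`δ' = 1 + √(t - T)₊` and outside the parabolic ball of radius `2δ'`, `|x - y| ≥ δ'`,
`|K| ≤ A |x - y|^{-m}`, and `lintegral_slab_shell_rpow_neg_mul_le` (`m > 3`) applies. [folklore] -/
theorem integrable_kernel_mul_of_morrey_fwd {K F : ℝ × ℝ³ → ℂ} {A B m d T : ℝ}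
    (hK : Measurable K) (hF : Measurable F) (hB : 0 ≤ B) (hm : 3 < m) (hmd : m < d)
    (hK0 : ∀ z : ℝ × ℝ³, z.1 ≤ 0 → K z = 0) (hK1 : ∀ z, ‖K z‖ * parabolicNorm z ^ m ≤ A)
    (hFT : ∀ w : ℝ × ℝ³, w.1 ≤ T → F w = 0)
    (hMor : ∀ (c : ℝ × ℝ³) (r : ℝ), 0 < r →
      ∫⁻ w in FluidPDE.parabolicCylinderCentered r c, ‖F w‖ₑ ≤ ENNReal.ofReal (B * r ^ d))
    (z : ℝ × ℝ³) : Integrable (fun w => K (z - w) * F w) := by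
  have hm0 : 0 < m := by linarith
  have hA : 0 ≤ A :=
    le_trans (mul_nonneg (norm_nonneg _) (Real.rpow_nonneg (parabolicNorm_nonneg _) m)) (hK1 0)
  have hK00 : K 0 = 0 := hK0 0 le_rfl
  have hKm : Measurable fun w => K (z - w) := hK.comp (measurable_const.sub measurable_id)
  have hFm : AEMeasurable (fun w => ‖F w‖ₑ) volume := hF.enorm.aemeasurable
  refine ⟨(hKm.mul hF).aestronglyMeasurable, ?_⟩
  -- the slab depth and the radii
  set L : ℝ := max (z.1 - T) 0 with hL
  have hL0 : 0 ≤ L := le_max_right _ _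
  set δ' : ℝ := 1 + Real.sqrt L with hδ'
  have hδ'0 : 0 < δ' := by have := Real.sqrt_nonneg L; rw [hδ']; linarith
  have hLδ : L < δ' ^ 2 := by
    rw [hδ']
    nlinarith [Real.sq_sqrt hL0, Real.sqrt_nonneg L]
  set R : ℝ := 2 * δ' with hR
  -- pointwise bounds
  have hnear : ∀ w, ‖K (z - w)‖ₑ * ‖F w‖ₑ ≤
      ENNReal.ofReal A * (ENNReal.ofReal (parabolicNorm (z - w) ^ (-m)) * ‖F w‖ₑ) := fun w => by
    rw [← mul_assoc]
    exact mul_le_mul' (enorm_le_of_mul_rpow_le hK00 hK1 (z - w)) le_rfl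
  set S : Set (ℝ × ℝ³) := {w : ℝ × ℝ³ | w.1 ∈ Ioo (z.1 - 2 * δ' ^ 2) z.1 ∧ δ' ≤ ‖z.2 - w.2‖} with hS
  have hSm : MeasurableSet S := by
    have h1 : MeasurableSet {w : ℝ × ℝ³ | w.1 ∈ Ioo (z.1 - 2 * δ' ^ 2) z.1} :=
      measurable_fst measurableSet_Ioo
    have h2 : MeasurableSet {w : ℝ × ℝ³ | δ' ≤ ‖z.2 - w.2‖} :=
      measurableSet_le measurable_const ((measurable_const.sub measurable_snd).norm)
    exact h1.inter h2
  set f : ℝ × ℝ³ → ℝ≥0∞ := fun w => ENNReal.ofReal (‖z.2 - w.2‖ ^ (-m)) * ‖F w‖ₑ with hf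
  have hfar : ∀ w, w ∉ parabolicBall z R → ‖K (z - w)‖ₑ * ‖F w‖ₑ ≤
      ENNReal.ofReal A * S.indicator f w := by
    intro w hw
    by_cases hKF : K (z - w) * F w = 0
    · have : ‖K (z - w)‖ₑ * ‖F w‖ₑ = 0 := by rw [← enorm_mul, hKF, enorm_zero]
      rw [this]
      exact zero_le
    have hKw : K (z - w) ≠ 0 := left_ne_zero_of_mul hKF
    have hFw : F w ≠ 0 := right_ne_zero_of_mul hKF
    have hτpos : 0 < (z - w).1 := lt_of_not_ge fun h => hKw (hK0 _ h)
    have hwT : T < w.1 := lt_of_not_ge fun h => hFw (hFT w h)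
    have hfst : (z - w).1 = z.1 - w.1 := rfl
    have hτL : (z - w).1 ≤ L := le_trans (by linarith) (le_max_left _ _)
    have hlow : z.1 - 2 * δ' ^ 2 < w.1 := by nlinarith
    have hup : w.1 < z.1 := by linarith
    have hsqrt : Real.sqrt ((z - w).1) ≤ Real.sqrt L := Real.sqrt_le_sqrt hτL
    have hρeq : parabolicNorm (z - w) = Real.sqrt ((z - w).1) + ‖z.2 - w.2‖ := by
      have := parabolicNorm_mk_of_nonneg hτpos.le (z - w).2
      rw [Prod.mk.eta] at this
      rw [this]
      rfl
    have hρR : R ≤ parabolicNorm (z - w) := by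
      rw [mem_parabolicBall, not_lt] at hw
      exact hw
    have hspace : δ' ≤ ‖z.2 - w.2‖ := by
      have : Real.sqrt L = δ' - 1 := by rw [hδ']; ring
      linarith
    have hne : (z - w).2 ≠ 0 := by
      intro h0
      have : ‖z.2 - w.2‖ = 0 := by rw [show z.2 - w.2 = (z - w).2 from rfl, h0, norm_zero]
      linarith
    have hmem : w ∈ S := ⟨⟨hlow, hup⟩, hspace⟩
    rw [indicator_of_mem hmem, ← mul_assoc]
    refine mul_le_mul' ?_ le_rfl
    have hKn : ‖K (z - w)‖ ≤ A * ‖(z - w).2‖ ^ (-m) := norm_le_mul_norm_snd_rpow_neg hm0 hK1 hne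
    rw [← ofReal_norm, ← ENNReal.ofReal_mul hA]
    exact ENNReal.ofReal_le_ofReal hKn
  -- finiteness
  have hball : MeasurableSet (parabolicBall z R) := measurableSet_parabolicBall z R
  unfold HasFiniteIntegral
  simp_rw [enorm_mul]
  rw [← lintegral_add_compl _ hball]
  refine ENNReal.add_lt_top.2 ⟨?_, ?_⟩
  · calc ∫⁻ w in parabolicBall z R, ‖K (z - w)‖ₑ * ‖F w‖ₑ
        ≤ ∫⁻ w in parabolicBall z R, ENNReal.ofReal A *
            (ENNReal.ofReal (parabolicNorm (z - w) ^ (-m)) * ‖F w‖ₑ) := lintegral_mono fun w => hnear w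
      _ = ENNReal.ofReal A * ∫⁻ w in parabolicBall z R,
            ENNReal.ofReal (parabolicNorm (z - w) ^ (-m)) * ‖F w‖ₑ :=
          lintegral_const_mul' _ _ ENNReal.ofReal_ne_top
      _ < ⊤ := by
          refine ENNReal.mul_lt_top ENNReal.ofReal_lt_top ?_
          exact (lintegral_parabolicBall_rpow_neg_mul_le hB hm0 hmd hFm hMor z
            (by positivity)).trans_lt ENNReal.ofReal_lt_top
  · calc ∫⁻ w in (parabolicBall z R)ᶜ, ‖K (z - w)‖ₑ * ‖F w‖ₑ
        ≤ ∫⁻ w in (parabolicBall z R)ᶜ, ENNReal.ofReal A * S.indicator f w :=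
          setLIntegral_mono' hball.compl fun w hw => hfar w hw
      _ ≤ ∫⁻ w, ENNReal.ofReal A * S.indicator f w := setLIntegral_le_lintegral _ _
      _ = ENNReal.ofReal A * ∫⁻ w in S, f w := by
          rw [lintegral_const_mul' _ _ ENNReal.ofReal_ne_top, lintegral_indicator hSm]
      _ < ⊤ := by
          refine ENNReal.mul_lt_top ENNReal.ofReal_lt_top ?_
          exact (lintegral_slab_shell_rpow_neg_mul_le hB hm hFm hMor z.1 z.2 hδ'0).trans_lt
            ENNReal.ofReal_lt_top



end Literature.Analysis.FluidPDE
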